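import Literature.NumberTheory.Automorphic.ModularLambdaNome
import Literature.Analysis.Complex.TaylorCoefficientsAlgebra
import Literature.RingTheory.PowerSeries.NthRootDenominatorType
import HarnessLib

/-!
# The analytic `N`-th root `(λ(tᴺ)/16)^{1/N}` has Taylor series the formal root `x(t)` of CDT

`Literature/NumberTheory/Automorphic/ModularLambdaRootTaylor.lean` — PROOF-ONLY (no definition, no
named fact). F. Calegari, V. Dimitrov, Y. Tang, *The unbounded denominators conjecture*, J. Amer. Math.
Soc. 38 (2025), proof of Proposition 3.0.1 (arXiv:2109.09040 §3, display (xt)): the uniformizing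
variable `x := (λ(τ)/16)^{1/N} ∈ t + t²ℤ[1/N]⟦t⟧`, `t = q^{1/N}`, is used simultaneously as a FORMAL
power series (hypothesis (ii) of Theorem 2.0.1: `p(x(t)) = x(t)ᴺ ∈ ℤ⟦t⟧`, and `x^* f ∈ ℤ⟦t⟧`) and as
a HOLOMORPHIC function of `t` (the competitor in the conformal-radius comparison, and the pull-back map
`φ`). The tree has both incarnations separately:
`ModularLambda.exists_formal_root_qExpansion_modularLambda` (formal: `x ∈ ℚ⟦t⟧`, `x ≡ t`, `xᴺ = L(tᴺ)`,
`L = qExpansion 2 (λ/16) ∈ ℤ⟦X⟧`) and `ModularLambda.exists_root_cuspFunction_modularLambda`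
(analytic: `Φ` holomorphic on the disc, `Φ(0) = 0`, `Φ′(0) = 1`, `Φ(z)ᴺ = Λ₁₆(zᴺ)`). Here we PROVE they
agree: the Taylor series of any such `Φ` at `0` is (the image in `ℂ⟦t⟧` of) any such `x`
(`taylorPowerSeries_root_eq_map_formal_root`) — both are `N`-th roots of `L(tᴺ)` with linear term `t`,
and such roots are unique (`Literature.RingTheory.PowerSeries.eq_of_pow_eq_of_constantCoeff_eq_one`).
This is the bridge («B5a» of the crux memo `Lines/cdt_thm1-core-map-g39.md` of K★ 22226) between the
formal hypotheses of the holonomy bound and the covering-space side of Proposition 3.0.1.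

## References
* [CalegariDimitrovTang2025] F. Calegari, V. Dimitrov, Y. Tang, J. Amer. Math. Soc. 38 (2025), §3,
  proof of Proposition 3.0.1, display (xt) (arXiv v1: Proposition 15).
-/

noncomputable section

open Complex Real Filter Topology Function Metric Set
open UpperHalfPlane hiding I
open scoped Real Topology Manifold

namespace Literature.NumberTheory.Automorphic

namespace ModularLambda

/-- The Taylor series at `0` of `Λ₁₆ = λ/16` as a function of the nome is `qExpansion 2 (λ/16)`
(Mathlib's definition of `qExpansion`, rewritten with `/ n!`). [cite: CalegariDimitrovTang2025, §3 (xt)] -/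
theorem taylorPowerSeries_cuspFunction_modularLambda :
    PowerSeries.mk (fun n ↦ iteratedDeriv n (cuspFunction 2 (fun τ : ℍ ↦ modularLambda τ / 16)) 0 /
        n.factorial) = qExpansion 2 (fun τ : ℍ ↦ modularLambda τ / 16) := by
  ext n
  rw [PowerSeries.coeff_mk, qExpansion_coeff, div_eq_inv_mul]

/-- ★ **Taylor series of the analytic root = the formal root.** Let `N ≥ 1`, let `Φ` be holomorphic
on the unit disc with `Φ(0) = 0`, `Φ′(0) = 1` and `Φ(z)ᴺ = Λ₁₆(zᴺ)` there (e.g. the function of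
`exists_root_cuspFunction_modularLambda`), and let `x ∈ ℚ⟦t⟧` satisfy `x ≡ t (mod t²)` and
`xᴺ = L(tᴺ)` where `qExpansion 2 (λ/16) = L` (e.g. the series of
`exists_formal_root_qExpansion_modularLambda`). Then the Taylor series of `Φ` at `0` is `x` (mapped to
`ℂ⟦t⟧`). [cite: CalegariDimitrovTang2025, §3, proof of Proposition 3.0.1, display (xt)] -/
theorem taylorPowerSeries_root_eq_map_formal_root {N : ℕ} (hN : N ≠ 0) {Φ : ℂ → ℂ}
    (hΦd : DifferentiableOn ℂ Φ (ball 0 1)) (hΦ0 : Φ 0 = 0) (hΦ1 : deriv Φ 0 = 1)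
    (hpow : ∀ z ∈ ball (0 : ℂ) 1,
      Φ z ^ N = (cuspFunction 2 (fun τ : ℍ ↦ modularLambda τ / 16)) (z ^ N))
    {L : PowerSeries ℤ} (hL : qExpansion 2 (fun τ : ℍ ↦ modularLambda τ / 16) = L.map (Int.castRingHom ℂ))
    {x : PowerSeries ℚ} (hx0 : PowerSeries.constantCoeff x = 0) (hx1 : PowerSeries.coeff 1 x = 1)
    (hxN : x ^ N = PowerSeries.expand N hN (L.map (Int.castRingHom ℚ))) :
    PowerSeries.mk (fun n ↦ iteratedDeriv n Φ 0 / n.factorial) = x.map (algebraMap ℚ ℂ) := by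
  set Λ : ℂ → ℂ := cuspFunction 2 (fun τ : ℍ ↦ modularLambda τ / 16) with hΛ
  set T : PowerSeries ℂ := PowerSeries.mk (fun n ↦ iteratedDeriv n Φ 0 / n.factorial) with hT
  have hb : ball (0 : ℂ) 1 ∈ 𝓝 (0 : ℂ) := ball_mem_nhds _ one_pos
  have hΦan : AnalyticAt ℂ Φ 0 := hΦd.analyticAt hb
  have hΛan : AnalyticAt ℂ Λ 0 := differentiableOn_cuspFunction_modularLambda.analyticAt hb
  -- `Tᴺ = 𝓣(Φᴺ) = 𝓣(Λ ∘ (·)ᴺ) = subst (Xᴺ) (𝓣 Λ) = expand N (L.map ℂ)`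
  have hTN : T ^ N = PowerSeries.expand N hN (L.map (Int.castRingHom ℂ)) := by
    have h1 : T ^ N = PowerSeries.mk (fun n ↦ iteratedDeriv n (Φ ^ N) 0 / n.factorial) :=
      (Literature.Analysis.Complex.taylorPowerSeries_pow hΦan N).symm
    have h2 : PowerSeries.mk (fun n ↦ iteratedDeriv n (Φ ^ N) 0 / n.factorial) =
        PowerSeries.mk (fun n ↦ iteratedDeriv n (Λ ∘ fun z : ℂ ↦ z ^ N) 0 / n.factorial) := by
      refine Literature.Analysis.Complex.taylorPowerSeries_congr ?_
      filter_upwards [hb] with z hz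
      simp only [Pi.pow_apply, comp_apply]
      exact hpow z hz
    have h3 := Literature.Analysis.Complex.taylorPowerSeries_comp (u := Λ) (φ := fun z : ℂ ↦ z ^ N) hΛan
      ((analyticAt_id).pow N) (by simp [hN])
    rw [Literature.Analysis.Complex.taylorPowerSeries_pow_id, hΛ,
      taylorPowerSeries_cuspFunction_modularLambda, hL, ← PowerSeries.expand_apply] at h3
    rw [h1, h2, h3]
  -- `(x.map)ᴺ` is the same series
  have hmaps : (L.map (Int.castRingHom ℚ)).map (algebraMap ℚ ℂ) = L.map (Int.castRingHom ℂ) := by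
    have hcomp : (algebraMap ℚ ℂ).comp (Int.castRingHom ℚ) = Int.castRingHom ℂ := RingHom.ext_int _ _
    rw [← hcomp, PowerSeries.map_comp]
    rfl
  have hxN' : (x.map (algebraMap ℚ ℂ)) ^ N = PowerSeries.expand N hN (L.map (Int.castRingHom ℂ)) := by
    rw [← map_pow, hxN, PowerSeries.map_expand, hmaps]
  -- both are `X · (1 + …)`; cancel `Xᴺ` and use uniqueness of `N`-th roots with constant term `1`
  have hT0 : PowerSeries.constantCoeff T = 0 := by
    rw [hT, Literature.Analysis.Complex.constantCoeff_taylorPowerSeries, hΦ0]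
  have hT1 : PowerSeries.coeff 1 T = 1 := by
    rw [hT, PowerSeries.coeff_mk, iteratedDeriv_one, hΦ1, Nat.factorial_one, Nat.cast_one, div_one]
  obtain ⟨y, hy⟩ := PowerSeries.X_dvd_iff.mpr hT0
  have hX0 : PowerSeries.constantCoeff (x.map (algebraMap ℚ ℂ)) = 0 := by
    rw [← PowerSeries.coeff_zero_eq_constantCoeff_apply, PowerSeries.coeff_map,
      PowerSeries.coeff_zero_eq_constantCoeff_apply, hx0, map_zero]
  obtain ⟨y', hy'⟩ := PowerSeries.X_dvd_iff.mpr hX0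
  have hy1 : PowerSeries.constantCoeff y = 1 := by
    have h := congrArg (PowerSeries.coeff 1) hy
    rw [hT1, PowerSeries.coeff_succ_X_mul, PowerSeries.coeff_zero_eq_constantCoeff] at h
    exact h.symm
  have hy'1 : PowerSeries.constantCoeff y' = 1 := by
    have h := congrArg (PowerSeries.coeff 1) hy'
    rw [PowerSeries.coeff_map, hx1, PowerSeries.coeff_succ_X_mul,
      PowerSeries.coeff_zero_eq_constantCoeff] at h
    rw [← h, map_one]
  have hpowEq : y ^ N = y' ^ N := by
    have h : (PowerSeries.X : PowerSeries ℂ) ^ N * y ^ N = PowerSeries.X ^ N * y' ^ N := by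
      rw [← mul_pow, ← mul_pow, ← hy, ← hy', hTN, hxN']
    exact mul_left_cancel₀ (pow_ne_zero N PowerSeries.X_ne_zero) h
  have hyy' : y = y' :=
    Literature.RingTheory.PowerSeries.eq_of_pow_eq_of_constantCoeff_eq_one hN hy1 hy'1 hpowEq
  rw [hy, hyy', ← hy']

end ModularLambda

end Literature.NumberTheory.Automorphic

end
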